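import Mathlib.MeasureTheory.Function.AEEqOfIntegral
import Mathlib.MeasureTheory.Constructions.BorelSpace.Real
import Literature.NumberTheory.Transcendental.KZConstantTerm
import HarnessLib

/-!
# Fibred relations of the Kontsevich–Zagier calculus (moves uniform in a parameter)

Definition request `defn-KZ.fibredRelations` (route KontsevichZagierPeriods/ValuedFieldSpecialisation,
items CTConstruction (clause CT2), ParametricLifting, ClassLevelExpansion(FibreDimOne),
FibredRelationsLeRelations). Companion to `KZCalculus.lean` (the calculus of moves),
`KZSliceFubini.lean` / `KZConstantTerm.lean` (slices `KZ.sliceValue R s` of a representation over the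
parameter coordinate `z 0 = s`) and `KZDominatedFamily.lean`.

An `(n+1)`-dimensional integral representation `R : KZ.IntegralRep (n + 1)` is read as the family of
its slices over the parameter `s = z 0`. A move of the KZ calculus [Kontsevich–Zagier 2001, §1.2,
rules (1)–(3)] between such representations is **fibred** when it commutes with the projection to
the parameter coordinate, i.e. it is a family of moves in the fibre variables applied uniformly in
the parameter (the "rules relative to a base" of Ayoub's relative version of the period conjecture,
Ayoub 2015, §1, there over a formal disc). Precisely, the set `KZ.fibredGenerators ⊆ KZ.FormalRep`
consists of

* every instance of domain additivity `KZ.domainAddRel` and of integrand additivity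
  `KZ.integrandAddRel` (all dimensions; they never move points);
* the **fibred changes of variables** `KZ.fibredChangeOfVariablesRel`: the data of
  `KZ.changeOfVariablesRel` for `r r' : IntegralRep (n + 1)` with the extra clause
  `∀ x ∈ r.domain, Φ x 0 = x 0` (the substitution preserves the parameter);
* the **fibred Newton–Leibniz moves** `KZ.fibredNewtonLeibnizRel`: the elements of
  `KZ.newtonLeibnizRel` of the shape `of r − of r'` with `r : IntegralRep (n + 2)`,
  `r' : IntegralRep (n + 1)` — Newton–Leibniz along the LAST coordinate over a base of dimension
  `≥ 1`, so that the parameter coordinate `0` is a base coordinate and is untouched;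

and `KZ.fibredRelations := AddSubgroup.closure KZ.fibredGenerators`. The set `fibredGenerators` is
COPIED VERBATIM from the text inlined in the route declarations `CTConstruction` (CT2),
`ParametricLifting`, `ClassLevelExpansion`, `ClassLevelExpansionFibreDimOne`,
`FibredRelationsLeRelations` of
`Summits/KontsevichZagierPeriods/KontsevichZagierPeriods/Theses/ValuedFieldSpecialisation.lean`, so
that restating those items through `KZ.fibredRelations` is definitional (`fibredGenerators_def`,
`fibredRelations_def` are `rfl`; the route's `FibredRelationsLeRelations` is, definitionally,
`fibredRelations_le_relations`).

## Main definitions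

* `Literature.NumberTheory.Transcendental.KZ.fibredChangeOfVariablesRel`,
  `KZ.fibredNewtonLeibnizRel`, `KZ.fibredGenerators`, `KZ.fibredRelations`,
  `KZ.FibredEquivalent r r'` (`of r − of r' ∈ fibredRelations`).
* `KZ.paramSlab n a b = {z : ℝⁿ⁺¹ | a < z 0 < b}` for rational `a b`, `KZ.IntegralRep.slabRestrict`
  (restriction of a family to the slab, via `IntegralRep.restrict`), `KZ.IntegralRep.slabCompl`;
  `KZ.slabMap a b : FormalRep →+ FormalRep` (slab restriction of formal combinations; generators of
  dimension `0` go to `0`) and `KZ.sliceEval : FormalRep →+ (ℝ → ℝ)` (the additive extension of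
  `sliceValue`; generators of dimension `0` go to `0`).

## Main statements (all proved)

* `fibredRelations_le_relations` — fibred chains are chains (each fibred generator is a KZ
  generator); `fibredRelations_le_ker_eval`; membership lemmas for the four kinds of generators,
  and `mem_fibredNewtonLeibnizRel_iff` (the fibred Newton–Leibniz set, defined verbatim as
  "`∈ newtonLeibnizRel` and of the dimension shape `(n+2, n+1)`", IS the set of Newton–Leibniz data
  over a base of dimension `n + 1` — by reading off coefficients in the free abelian group).
* **Slab restriction** (`slabMap_mem_fibredRelations`): restricting every representation of a
  fibred relation to a rational slab `{a < z 0 < b}` gives again a fibred relation — generatorwise: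
  `of_slabRestrict_mem_domainAddRel`, `of_slabRestrict_mem_integrandAddRel`,
  `of_slabRestrict_mem_fibredChangeOfVariablesRel`, `of_slabRestrict_mem_newtonLeibnizRel`;
  and cutting a family at rational parameter values is itself a fibred move
  (`of_sub_of_slabRestrict_sub_of_slabCompl_mem`).
* **Slices of fibred relations vanish a.e.** (`sliceEval_ae_eq_zero`): by slab restriction,
  soundness of the calculus (`relations_le_ker_eval_holds`) and Fubini over the parameter
  (`eval_slabMap : eval (slabMap a b c) = ∫ s in (a, b), sliceEval c s`), the slice function of a
  fibred relation has zero integral over every rational interval, hence vanishes for a.e. `s`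
  (`ae_eq_zero_of_forall_setIntegral_Ioo_rat_eq_zero`, a π-λ argument on
  `Real.borel_eq_generateFrom_Ioo_rat`). In particular fibred-equivalent families have a.e. equal
  slice values (`FibredEquivalent.sliceValue_ae_eq`) and equal slice integrals over every rational
  parameter interval (`FibredEquivalent.setIntegral_sliceValue_eq`).

## References

* M. Kontsevich, D. Zagier, *Periods*, in: Mathematics Unlimited — 2001 and Beyond, Springer
  (2001), §1.2 (the three rules). [cite: KontsevichZagier2001]
* J. Ayoub, *Une version relative de la conjecture des périodes de Kontsevich–Zagier*, Ann. of
  Math. 181 (2015), §1 (relations relative to a base: Stokes in the fibre variables, parameter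
  fixed).
* J. Bochnak, M. Coste, M.-F. Roy, *Real Algebraic Geometry* (1998), §2.1–2.2.

## Design notes / what is NOT here

* "Almost every `s`" is the most the total-space data give: the slice of an absolutely integrable
  integrand need not be integrable at a given `s`, where `sliceValue` then takes the junk value `0`
  (cf. the module docstring of `KZSliceFubini.lean`). The refinement "for all small `s` off a finite
  set" expected for semialgebraic data needs o-minimal finiteness and is not attempted; statements
  about constant terms as `s → 0⁺` (`KZ.HasConstantTerm`) need every small `s` and do NOT follow
  from the a.e. statement.
* `slabMap` and `sliceEval` send generators of dimension `0` (constants, which are not families) to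
  `0`; this keeps `eval ∘ slabMap a b = ∫_{(a,b)} ∘ sliceEval` an identity on all of `FormalRep`.
  Dimension-`0` instances of the additivity moves are fibred generators (the route includes all
  instances) and restrict to `0 ∈ fibredRelations`.
* Slabs have rational ends so that they are `ℚ`-semialgebraic with no appeal to real-algebraic
  parameters; rational intervals generate the Borel σ-algebra, which is all the a.e. argument uses.
-/

noncomputable section

open MeasureTheory Set Filter MvPolynomial
open scoped Topology

namespace Literature.NumberTheory.Transcendental

namespace KZ

variable {n m l : ℕ}

/-! ### The fibred generators and the fibred relations -/

/-- **Fibred change of variables.** The data of the change-of-variables move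
`KZ.changeOfVariablesRel` [KZ 2001, §1.2 rule (2)] between two `(n+1)`-dimensional representations
`r`, `r'` — `Φ` a `ℚ`-semialgebraic map on `r.domain`, injective there, with derivative `Φ' x`
within `r.domain` at each of its points, `r'.domain = Φ '' r.domain`,
`r.integrand x = r'.integrand (Φ x) * |det (Φ' x)|` — with the extra clause that `Φ` preserves the
parameter coordinate, `Φ x 0 = x 0` on `r.domain` (a family of substitutions in the fibre variables).
Verbatim the third set of the union inlined in route ValuedFieldSpecialisation (CT2).
[cite: KontsevichZagier2001, §1.2 rule (2)] -/
def fibredChangeOfVariablesRel : Set FormalRep :=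
  {c | ∃ (n : ℕ) (r r' : IntegralRep (n + 1)) (Φ : (Fin (n + 1) → ℝ) → (Fin (n + 1) → ℝ))
      (Φ' : (Fin (n + 1) → ℝ) → (Fin (n + 1) → ℝ) →L[ℝ] (Fin (n + 1) → ℝ)),
    IsSemialgebraicMapOn ℚ r.domain Φ ∧ (∀ x ∈ r.domain, HasFDerivWithinAt Φ (Φ' x) r.domain x) ∧
    Set.InjOn Φ r.domain ∧ r'.domain = Φ '' r.domain ∧
    (∀ x ∈ r.domain, r.integrand x = r'.integrand (Φ x) * |(Φ' x).det|) ∧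
    (∀ x ∈ r.domain, Φ x 0 = x 0) ∧ c = of r - of r'}

/-- **Fibred Newton–Leibniz moves.** The elements of `KZ.newtonLeibnizRel` [KZ 2001, §1.2 rule (3),
fixed in `KZCalculus.lean` as Newton–Leibniz along the last coordinate of a band over a base] of the
shape `of r − of r'` with `r : IntegralRep (n + 2)` the band and `r' : IntegralRep (n + 1)`: the base
has dimension `≥ 1`, so the parameter coordinate `0` is a base coordinate and the move is fibrewise
in the parameter. Verbatim the fourth set of the union inlined in route ValuedFieldSpecialisation
(CT2); `mem_fibredNewtonLeibnizRel_iff` unfolds it into Newton–Leibniz data over a base of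
dimension `n + 1`. [cite: KontsevichZagier2001, §1.2 rule (3)] -/
def fibredNewtonLeibnizRel : Set FormalRep :=
  {c | c ∈ newtonLeibnizRel ∧ ∃ (n : ℕ) (r : IntegralRep (n + 2)) (r' : IntegralRep (n + 1)),
    c = of r - of r'}

/-- **The fibred move generators**: all instances of domain additivity and of integrand additivity,
the fibred changes of variables and the fibred Newton–Leibniz moves. This is, VERBATIM, the set
inlined in the route declarations `CTConstruction` (CT2), `ParametricLifting`, `ClassLevelExpansion`,
`ClassLevelExpansionFibreDimOne`, `FibredRelationsLeRelations` of route ValuedFieldSpecialisation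
(summit KontsevichZagierPeriods); `fibredGenerators_def` identifies it with
`domainAddRel ∪ integrandAddRel ∪ fibredChangeOfVariablesRel ∪ fibredNewtonLeibnizRel` by `rfl`.
[cite: KontsevichZagier2001, §1.2 rules (1)–(3)] -/
def fibredGenerators : Set FormalRep :=
  domainAddRel ∪ integrandAddRel ∪
    {c | ∃ (n : ℕ) (r r' : IntegralRep (n + 1)) (Φ : (Fin (n + 1) → ℝ) → (Fin (n + 1) → ℝ))
        (Φ' : (Fin (n + 1) → ℝ) → (Fin (n + 1) → ℝ) →L[ℝ] (Fin (n + 1) → ℝ)),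
      IsSemialgebraicMapOn ℚ r.domain Φ ∧
      (∀ x ∈ r.domain, HasFDerivWithinAt Φ (Φ' x) r.domain x) ∧ Set.InjOn Φ r.domain ∧
      r'.domain = Φ '' r.domain ∧
      (∀ x ∈ r.domain, r.integrand x = r'.integrand (Φ x) * |(Φ' x).det|) ∧
      (∀ x ∈ r.domain, Φ x 0 = x 0) ∧ c = of r - of r'} ∪
    {c | c ∈ newtonLeibnizRel ∧ ∃ (n : ℕ) (r : IntegralRep (n + 2)) (r' : IntegralRep (n + 1)),
      c = of r - of r'}

/-- **The fibred relations**: the subgroup of `FormalRep` generated by the fibred move generators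
(chains of moves applied uniformly in the parameter `z 0`).
[cite: KontsevichZagier2001, §1.2] -/
def fibredRelations : AddSubgroup FormalRep :=
  AddSubgroup.closure fibredGenerators

/-- Two integral representations are **fibred-equivalent** if their difference is a fibred
relation: `of r − of r' ∈ fibredRelations`. [cite: KontsevichZagier2001, §1.2] -/
def FibredEquivalent (r : IntegralRep n) (r' : IntegralRep m) : Prop :=
  of r - of r' ∈ fibredRelations

/-- The fibred generators are the union of the four kinds (definitional).
[cite: KontsevichZagier2001, §1.2] -/
theorem fibredGenerators_def :
    fibredGenerators =
      domainAddRel ∪ integrandAddRel ∪ fibredChangeOfVariablesRel ∪ fibredNewtonLeibnizRel :=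
  rfl

/-- `fibredRelations` is the closure of the fibred generators (definitional).
[cite: KontsevichZagier2001, §1.2] -/
theorem fibredRelations_def : fibredRelations = AddSubgroup.closure fibredGenerators := rfl

/-- Unfolding `FibredEquivalent` (definitional). [cite: KontsevichZagier2001, §1.2] -/
theorem fibredEquivalent_iff (r : IntegralRep n) (r' : IntegralRep m) :
    FibredEquivalent r r' ↔ of r - of r' ∈ fibredRelations :=
  Iff.rfl

/-- Membership in the fibred generators, by kind. [cite: KontsevichZagier2001, §1.2] -/
theorem mem_fibredGenerators_iff {c : FormalRep} :
    c ∈ fibredGenerators ↔ c ∈ domainAddRel ∨ c ∈ integrandAddRel ∨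
      c ∈ fibredChangeOfVariablesRel ∨ c ∈ fibredNewtonLeibnizRel := by
  simp only [fibredGenerators_def, mem_union, or_assoc]

/-- Domain additivity instances are fibred generators. [cite: KontsevichZagier2001, §1.2 rule (1)] -/
theorem domainAddRel_subset_fibredGenerators : domainAddRel ⊆ fibredGenerators :=
  fun _ hc => Or.inl (Or.inl (Or.inl hc))

/-- Integrand additivity instances are fibred generators.
[cite: KontsevichZagier2001, §1.2 rule (1)] -/
theorem integrandAddRel_subset_fibredGenerators : integrandAddRel ⊆ fibredGenerators :=
  fun _ hc => Or.inl (Or.inl (Or.inr hc))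

/-- Fibred changes of variables are fibred generators. [cite: KontsevichZagier2001, §1.2 rule (2)] -/
theorem fibredChangeOfVariablesRel_subset_fibredGenerators :
    fibredChangeOfVariablesRel ⊆ fibredGenerators :=
  fun _ hc => Or.inl (Or.inr hc)

/-- Fibred Newton–Leibniz moves are fibred generators. [cite: KontsevichZagier2001, §1.2 rule (3)] -/
theorem fibredNewtonLeibnizRel_subset_fibredGenerators :
    fibredNewtonLeibnizRel ⊆ fibredGenerators :=
  fun _ hc => Or.inr hc

/-- A fibred change of variables is a change of variables (drop the clause `Φ x 0 = x 0`).
[cite: KontsevichZagier2001, §1.2 rule (2)] -/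
theorem fibredChangeOfVariablesRel_subset_changeOfVariablesRel :
    fibredChangeOfVariablesRel ⊆ changeOfVariablesRel := by
  rintro c ⟨n, r, r', Φ, Φ', hΦ, hΦ', hinj, hdom, hf, -, rfl⟩
  exact ⟨n + 1, r, r', Φ, Φ', hΦ, hΦ', hinj, hdom, hf, rfl⟩

/-- A fibred Newton–Leibniz move is a Newton–Leibniz move (its first conjunct).
[cite: KontsevichZagier2001, §1.2 rule (3)] -/
theorem fibredNewtonLeibnizRel_subset_newtonLeibnizRel :
    fibredNewtonLeibnizRel ⊆ newtonLeibnizRel :=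
  fun _ hc => hc.1

/-- Every fibred generator is a generator of the KZ calculus. [cite: KontsevichZagier2001, §1.2] -/
theorem fibredGenerators_subset_generators :
    fibredGenerators ⊆
      domainAddRel ∪ integrandAddRel ∪ changeOfVariablesRel ∪ newtonLeibnizRel := by
  rintro c (((hc | hc) | hc) | hc)
  · exact Or.inl (Or.inl (Or.inl hc))
  · exact Or.inl (Or.inl (Or.inr hc))
  · exact Or.inl (Or.inr (fibredChangeOfVariablesRel_subset_changeOfVariablesRel hc))
  · exact Or.inr (fibredNewtonLeibnizRel_subset_newtonLeibnizRel hc)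

/-- Every fibred generator is a relation of the KZ calculus. [cite: KontsevichZagier2001, §1.2] -/
theorem fibredGenerators_subset_relations : fibredGenerators ⊆ relations :=
  fun _ hc => AddSubgroup.subset_closure (fibredGenerators_subset_generators hc)

/-- The fibred generators are fibred relations. [cite: KontsevichZagier2001, §1.2] -/
theorem fibredGenerators_subset_fibredRelations :
    fibredGenerators ⊆ (fibredRelations : Set FormalRep) :=
  AddSubgroup.subset_closure

/-- **Fibred chains are chains**: `fibredRelations ≤ relations` (`AddSubgroup.closure_le` and
`fibredGenerators_subset_relations`). Definitionally the route support item
`FibredRelationsLeRelations`. [cite: KontsevichZagier2001, §1.2] -/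
theorem fibredRelations_le_relations : fibredRelations ≤ relations :=
  (AddSubgroup.closure_le _).mpr fibredGenerators_subset_relations

/-- Fibred relations evaluate to `0` (soundness of the calculus, `relations_le_ker_eval_holds`).
[cite: KontsevichZagier2001, §1.2] -/
theorem fibredRelations_le_ker_eval : fibredRelations ≤ eval.ker :=
  fibredRelations_le_relations.trans relations_le_ker_eval_holds

/-- A domain additivity instance is a fibred relation. [cite: KontsevichZagier2001, §1.2 rule (1)] -/
theorem mem_fibredRelations_of_mem_domainAddRel {c : FormalRep} (hc : c ∈ domainAddRel) :
    c ∈ fibredRelations :=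
  fibredGenerators_subset_fibredRelations (domainAddRel_subset_fibredGenerators hc)

/-- An integrand additivity instance is a fibred relation.
[cite: KontsevichZagier2001, §1.2 rule (1)] -/
theorem mem_fibredRelations_of_mem_integrandAddRel {c : FormalRep} (hc : c ∈ integrandAddRel) :
    c ∈ fibredRelations :=
  fibredGenerators_subset_fibredRelations (integrandAddRel_subset_fibredGenerators hc)

/-- A fibred change of variables is a fibred relation. [cite: KontsevichZagier2001, §1.2 rule (2)] -/
theorem mem_fibredRelations_of_mem_fibredChangeOfVariablesRel {c : FormalRep}
    (hc : c ∈ fibredChangeOfVariablesRel) : c ∈ fibredRelations :=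
  fibredGenerators_subset_fibredRelations (fibredChangeOfVariablesRel_subset_fibredGenerators hc)

/-- A fibred Newton–Leibniz move is a fibred relation. [cite: KontsevichZagier2001, §1.2 rule (3)] -/
theorem mem_fibredRelations_of_mem_fibredNewtonLeibnizRel {c : FormalRep}
    (hc : c ∈ fibredNewtonLeibnizRel) : c ∈ fibredRelations :=
  fibredGenerators_subset_fibredRelations (fibredNewtonLeibnizRel_subset_fibredGenerators hc)

/-- Constructor for fibred changes of variables from their data.
[cite: KontsevichZagier2001, §1.2 rule (2)] -/
theorem of_sub_of_mem_fibredChangeOfVariablesRel {r r' : IntegralRep (n + 1)}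
    {Φ : (Fin (n + 1) → ℝ) → (Fin (n + 1) → ℝ)}
    {Φ' : (Fin (n + 1) → ℝ) → (Fin (n + 1) → ℝ) →L[ℝ] (Fin (n + 1) → ℝ)}
    (hΦ : IsSemialgebraicMapOn ℚ r.domain Φ)
    (hΦ' : ∀ x ∈ r.domain, HasFDerivWithinAt Φ (Φ' x) r.domain x) (hinj : InjOn Φ r.domain)
    (hdom : r'.domain = Φ '' r.domain)
    (hf : ∀ x ∈ r.domain, r.integrand x = r'.integrand (Φ x) * |(Φ' x).det|)
    (h0 : ∀ x ∈ r.domain, Φ x 0 = x 0) :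
    of r - of r' ∈ fibredChangeOfVariablesRel :=
  ⟨n, r, r', Φ, Φ', hΦ, hΦ', hinj, hdom, hf, h0, rfl⟩

/-- A Newton–Leibniz move `of r − of r'` with band `r : IntegralRep (n + 2)` over a base
`r' : IntegralRep (n + 1)` of dimension `≥ 1` is fibred. [cite: KontsevichZagier2001, §1.2 rule (3)] -/
theorem of_sub_of_mem_fibredNewtonLeibnizRel {r : IntegralRep (n + 2)} {r' : IntegralRep (n + 1)}
    (h : of r - of r' ∈ newtonLeibnizRel) : of r - of r' ∈ fibredNewtonLeibnizRel :=
  ⟨h, n, r, r', rfl⟩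

/-- In the free abelian group on integral representations, `of x − of y = of x' − of y'` with
`x ≠ y` forces `x' = x` and `y' = y` (read off the coefficients of `x` and of `y`). [folklore] -/
theorem sigma_eq_of_of_sub_of_eq {x y x' y' : Σ k, IntegralRep k} (hxy : x ≠ y)
    (h : (FreeAbelianGroup.of x - FreeAbelianGroup.of y : FormalRep) =
      FreeAbelianGroup.of x' - FreeAbelianGroup.of y') :
    x' = x ∧ y' = y := by
  classical
  let φ : (Σ k, IntegralRep k) → FormalRep →+ ℤ := fun z =>
    FreeAbelianGroup.lift fun w => if w = z then (1 : ℤ) else 0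
  have hx := congrArg (φ x) h
  have hy := congrArg (φ y) h
  simp only [φ, map_sub, FreeAbelianGroup.lift_apply_of] at hx hy
  refine ⟨?_, ?_⟩
  · by_contra h₁
    by_cases h₂ : y' = x <;> simp [h₁, h₂, hxy.symm] at hx
  · by_contra h₂
    by_cases h₁ : x' = y <;> simp [h₁, h₂, hxy] at hy

/-- **The fibred Newton–Leibniz set, unfolded**: `c ∈ fibredNewtonLeibnizRel` iff `c = of r − of r'`
for Newton–Leibniz data (band `r`, base `r'`, bounds `a ≤ b`, primitive `F`, exactly the clauses of
`KZ.newtonLeibnizRel`) over a base `r' : IntegralRep (n + 1)` of dimension `≥ 1`. (The verbatim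
definition only pins the dimensions; the coefficients of the free abelian group identify the data,
`sigma_eq_of_of_sub_of_eq`.) [cite: KontsevichZagier2001, §1.2 rule (3)] -/
theorem mem_fibredNewtonLeibnizRel_iff {c : FormalRep} :
    c ∈ fibredNewtonLeibnizRel ↔
      ∃ (n : ℕ) (r : IntegralRep (n + 2)) (r' : IntegralRep (n + 1)) (a b : (Fin (n + 1) → ℝ) → ℝ)
        (F : (Fin (n + 2) → ℝ) → ℝ),
        IsSemialgebraicFunOn ℚ r.domain F ∧
        IsSemialgebraicFunOn ℚ r'.domain a ∧ IsSemialgebraicFunOn ℚ r'.domain b ∧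
        (∀ x ∈ r'.domain, a x ≤ b x) ∧
        r.domain = {z | (Fin.init z : Fin (n + 1) → ℝ) ∈ r'.domain ∧
          a (Fin.init z) ≤ z (Fin.last (n + 1)) ∧ z (Fin.last (n + 1)) ≤ b (Fin.init z)} ∧
        (∀ x ∈ r'.domain, ContinuousOn (fun t : ℝ => F (Fin.snoc x t)) (Icc (a x) (b x))) ∧
        (∀ x ∈ r'.domain, ∀ t ∈ Ioo (a x) (b x),
          HasDerivAt (fun s : ℝ => F (Fin.snoc x s)) (r.integrand (Fin.snoc x t)) t) ∧
        (∀ x ∈ r'.domain, r'.integrand x = F (Fin.snoc x (b x)) - F (Fin.snoc x (a x))) ∧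
        c = of r - of r' := by
  constructor
  · rintro ⟨⟨m, ρ, ρ', a, b, F, hF, ha, hb, hle, hband, hcont, hderiv, hρ', rfl⟩, k, r, r', h⟩
    have hne : (⟨m + 1, ρ⟩ : Σ k, IntegralRep k) ≠ ⟨m, ρ'⟩ := fun h' => by
      have := congrArg Sigma.fst h'
      simp at this
    have hm : m = k + 1 := by
      have := congrArg Sigma.fst (sigma_eq_of_of_sub_of_eq hne h).1
      simp only at this
      omega
    subst hm
    exact ⟨k, ρ, ρ', a, b, F, hF, ha, hb, hle, hband, hcont, hderiv, hρ', rfl⟩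
  · rintro ⟨k, r, r', a, b, F, hF, ha, hb, hle, hband, hcont, hderiv, hr', rfl⟩
    exact ⟨⟨k + 1, r, r', a, b, F, hF, ha, hb, hle, hband, hcont, hderiv, hr', rfl⟩, k, r, r', rfl⟩

namespace FibredEquivalent

/-- Fibred equivalence is reflexive. [cite: KontsevichZagier2001, §1.2] -/
@[refl] protected theorem refl (r : IntegralRep n) : FibredEquivalent r r := by
  simp [FibredEquivalent, fibredRelations.zero_mem]

/-- Fibred equivalence is symmetric. [cite: KontsevichZagier2001, §1.2] -/
@[symm] protected theorem symm {r : IntegralRep n} {r' : IntegralRep m} (h : FibredEquivalent r r') :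
    FibredEquivalent r' r := by
  simpa [FibredEquivalent] using fibredRelations.neg_mem h

/-- Fibred equivalence is transitive. [cite: KontsevichZagier2001, §1.2] -/
@[trans] protected theorem trans {r : IntegralRep n} {r' : IntegralRep m} {r'' : IntegralRep l}
    (h : FibredEquivalent r r') (h' : FibredEquivalent r' r'') : FibredEquivalent r r'' := by
  simpa [FibredEquivalent] using fibredRelations.add_mem h h'

/-- Fibred-equivalent representations are equivalent. [cite: KontsevichZagier2001, §1.2] -/
theorem equivalent {r : IntegralRep n} {r' : IntegralRep m} (h : FibredEquivalent r r') :
    Equivalent r r' :=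
  fibredRelations_le_relations h

/-- Fibred-equivalent representations represent the same number. [cite: KontsevichZagier2001, §1.2] -/
theorem value_eq {r : IntegralRep n} {r' : IntegralRep m} (h : FibredEquivalent r r') :
    r.value = r'.value :=
  Equivalent.value_eq_holds h.equivalent

end FibredEquivalent

/-! ### Slabs over the parameter coordinate -/

/-- The **slab** `{z ∈ ℝⁿ⁺¹ | a < z 0 < b}` over the rational parameter interval `(a, b)`.
[cite: BochnakCosteRoy1998, §2.1] -/
def paramSlab (n : ℕ) (a b : ℚ) : Set (Fin (n + 1) → ℝ) := {z | (a : ℝ) < z 0 ∧ z 0 < b}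

/-- Membership in a slab (definitional). [cite: BochnakCosteRoy1998, §2.1] -/
@[simp] theorem mem_paramSlab {a b : ℚ} {z : Fin (n + 1) → ℝ} :
    z ∈ paramSlab n a b ↔ (a : ℝ) < z 0 ∧ z 0 < b :=
  Iff.rfl

/-- The slice point `(s, x)` lies in the slab iff `s ∈ (a, b)`. [cite: BochnakCosteRoy1998, §2.1] -/
theorem vecCons_mem_paramSlab {a b : ℚ} {s : ℝ} {x : Fin n → ℝ} :
    Matrix.vecCons s x ∈ paramSlab n a b ↔ s ∈ Ioo (a : ℝ) b := by
  simp [paramSlab]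

/-- A rational slab is `ℚ`-semialgebraic (two strict polynomial inequalities with rational
coefficients). [cite: BochnakCosteRoy1998, §2.1] -/
theorem isSemialgebraic_paramSlab (n : ℕ) (a b : ℚ) :
    Literature.ModelTheory.ExponentialFields.IsSemialgebraic ℚ (paramSlab n a b) := by
  have h1 : Literature.ModelTheory.ExponentialFields.IsSemialgebraic ℚ
      {z : Fin (n + 1) → ℝ | (a : ℝ) < z 0} := by
    simpa using Literature.ModelTheory.ExponentialFields.isSemialgebraic_setOf_eval_lt
      (k := ℚ) (R := ℝ) (C a) (X (0 : Fin (n + 1)))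
  have h2 : Literature.ModelTheory.ExponentialFields.IsSemialgebraic ℚ
      {z : Fin (n + 1) → ℝ | z 0 < b} := by
    simpa using Literature.ModelTheory.ExponentialFields.isSemialgebraic_setOf_eval_lt
      (k := ℚ) (R := ℝ) (X (0 : Fin (n + 1))) (C b)
  simpa [paramSlab, setOf_and] using h1.inter h2

namespace IntegralRep

/-- **Slab restriction** of a family: the restriction (`IntegralRep.restrict`) of an
`(n+1)`-dimensional representation to `r.domain ∩ {a < z 0 < b}`, `a b` rational.
[cite: KontsevichZagier2001, §1.2] -/
def slabRestrict (r : IntegralRep (n + 1)) (a b : ℚ) : IntegralRep (n + 1) :=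
  r.restrict (r.domain ∩ paramSlab n a b) (r.isSemialgebraic_domain.inter (isSemialgebraic_paramSlab n a b))
    inter_subset_left

/-- The complementary restriction of a family, to `r.domain ∖ {a < z 0 < b}`.
[cite: KontsevichZagier2001, §1.2] -/
def slabCompl (r : IntegralRep (n + 1)) (a b : ℚ) : IntegralRep (n + 1) :=
  r.restrict (r.domain \ paramSlab n a b) (r.isSemialgebraic_domain.diff (isSemialgebraic_paramSlab n a b))
    sdiff_subset

/-- The domain of a slab restriction. [cite: KontsevichZagier2001, §1.2] -/
@[simp] theorem domain_slabRestrict (r : IntegralRep (n + 1)) (a b : ℚ) :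
    (r.slabRestrict a b).domain = r.domain ∩ paramSlab n a b :=
  rfl

/-- The integrand of a slab restriction. [cite: KontsevichZagier2001, §1.2] -/
@[simp] theorem integrand_slabRestrict (r : IntegralRep (n + 1)) (a b : ℚ) :
    (r.slabRestrict a b).integrand = r.integrand :=
  rfl

/-- The domain of the complementary restriction. [cite: KontsevichZagier2001, §1.2] -/
@[simp] theorem domain_slabCompl (r : IntegralRep (n + 1)) (a b : ℚ) :
    (r.slabCompl a b).domain = r.domain \ paramSlab n a b :=
  rfl

/-- The integrand of the complementary restriction. [cite: KontsevichZagier2001, §1.2] -/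
@[simp] theorem integrand_slabCompl (r : IntegralRep (n + 1)) (a b : ℚ) :
    (r.slabCompl a b).integrand = r.integrand :=
  rfl

/-- **Cutting a family at rational parameter values is a (fibred) move**: `[r] − [r|slab] − [r|∁slab]`
is a domain-additivity instance. [cite: KontsevichZagier2001, §1.2 rule (1)] -/
theorem of_sub_of_slabRestrict_sub_of_slabCompl_mem (r : IntegralRep (n + 1)) (a b : ℚ) :
    of r - of (r.slabRestrict a b) - of (r.slabCompl a b) ∈ domainAddRel :=
  ⟨n + 1, r, r.slabRestrict a b, r.slabCompl a b, by simp [inter_union_sdiff],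
    measure_mono_null (fun _ hz => (hz.2.2 hz.1.2).elim) measure_empty,
    fun _ _ => rfl, fun _ _ => rfl, rfl⟩

/-- The slices of a slab restriction: `sliceValue (r|slab) s = 𝟙_{(a,b)}(s) · sliceValue r s`.
[folklore] -/
theorem sliceValue_slabRestrict (r : IntegralRep (n + 1)) (a b : ℚ) (s : ℝ) :
    sliceValue (r.slabRestrict a b) s = (Ioo (a : ℝ) b).indicator (sliceValue r) s := by
  by_cases hs : s ∈ Ioo (a : ℝ) b
  · rw [indicator_of_mem hs, sliceValue_def, sliceValue_def]
    have hset : {x : Fin n → ℝ | Matrix.vecCons s x ∈ (r.slabRestrict a b).domain} =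
        {x : Fin n → ℝ | Matrix.vecCons s x ∈ r.domain} :=
      Set.ext fun x => ⟨fun hx => hx.1, fun hx => ⟨hx, vecCons_mem_paramSlab.mpr hs⟩⟩
    rw [hset]
    rfl
  · rw [indicator_of_notMem hs, sliceValue_def]
    have hset : {x : Fin n → ℝ | Matrix.vecCons s x ∈ (r.slabRestrict a b).domain} = ∅ :=
      eq_empty_of_forall_notMem fun x hx => hs (vecCons_mem_paramSlab.mp hx.2)
    rw [hset, Measure.restrict_empty, integral_zero_measure]

/-- **Fubini on a slab**: the value of `r|slab` is the integral of the slice values of `r` over the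
parameter interval, `(r|slab).value = ∫ s in (a, b), sliceValue r s`. [folklore] -/
theorem value_slabRestrict (r : IntegralRep (n + 1)) (a b : ℚ) :
    (r.slabRestrict a b).value = ∫ s in Ioo (a : ℝ) b, sliceValue r s := by
  rw [← integral_sliceValue, ← integral_indicator measurableSet_Ioo]
  exact integral_congr_ae (Eventually.of_forall (sliceValue_slabRestrict r a b))

end IntegralRep

/-! ### Slab restriction preserves the fibred generators -/

/-- Slab restriction of a domain-additivity instance (dimension `≥ 1`) is a domain-additivity
instance. [cite: KontsevichZagier2001, §1.2 rule (1)] -/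
theorem of_slabRestrict_mem_domainAddRel {r r₁ r₂ : IntegralRep (n + 1)}
    (hdom : r.domain = r₁.domain ∪ r₂.domain) (hnull : volume (r₁.domain ∩ r₂.domain) = 0)
    (h₁ : EqOn r.integrand r₁.integrand r₁.domain) (h₂ : EqOn r.integrand r₂.integrand r₂.domain)
    (a b : ℚ) :
    of (r.slabRestrict a b) - of (r₁.slabRestrict a b) - of (r₂.slabRestrict a b) ∈
      domainAddRel := by
  refine ⟨n + 1, r.slabRestrict a b, r₁.slabRestrict a b, r₂.slabRestrict a b, ?_, ?_,
    fun z hz => h₁ hz.1, fun z hz => h₂ hz.1, rfl⟩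
  · simp only [IntegralRep.domain_slabRestrict, hdom, union_inter_distrib_right]
  · exact measure_mono_null (fun z hz => mem_inter hz.1.1 hz.2.1) hnull

/-- Slab restriction of an integrand-additivity instance (dimension `≥ 1`) is an
integrand-additivity instance. [cite: KontsevichZagier2001, §1.2 rule (1)] -/
theorem of_slabRestrict_mem_integrandAddRel {r r₁ r₂ : IntegralRep (n + 1)}
    (h₁ : r₁.domain = r.domain) (h₂ : r₂.domain = r.domain)
    (hadd : EqOn r.integrand (r₁.integrand + r₂.integrand) r.domain) (a b : ℚ) :
    of (r.slabRestrict a b) - of (r₁.slabRestrict a b) - of (r₂.slabRestrict a b) ∈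
      integrandAddRel := by
  refine ⟨n + 1, r.slabRestrict a b, r₁.slabRestrict a b, r₂.slabRestrict a b, ?_, ?_,
    fun z hz => hadd hz.1, rfl⟩
  · simp only [IntegralRep.domain_slabRestrict, h₁]
  · simp only [IntegralRep.domain_slabRestrict, h₂]

/-- **Slab restriction of a fibred change of variables is a fibred change of variables**: since
`Φ` preserves `z 0`, it maps `r.domain ∩ slab` onto `r'.domain ∩ slab`; all other clauses restrict.
[cite: KontsevichZagier2001, §1.2 rule (2)] -/
theorem of_slabRestrict_mem_fibredChangeOfVariablesRel {r r' : IntegralRep (n + 1)}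
    {Φ : (Fin (n + 1) → ℝ) → (Fin (n + 1) → ℝ)}
    {Φ' : (Fin (n + 1) → ℝ) → (Fin (n + 1) → ℝ) →L[ℝ] (Fin (n + 1) → ℝ)}
    (hΦ : IsSemialgebraicMapOn ℚ r.domain Φ)
    (hΦ' : ∀ x ∈ r.domain, HasFDerivWithinAt Φ (Φ' x) r.domain x) (hinj : InjOn Φ r.domain)
    (hdom : r'.domain = Φ '' r.domain)
    (hf : ∀ x ∈ r.domain, r.integrand x = r'.integrand (Φ x) * |(Φ' x).det|)
    (h0 : ∀ x ∈ r.domain, Φ x 0 = x 0) (a b : ℚ) :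
    of (r.slabRestrict a b) - of (r'.slabRestrict a b) ∈ fibredChangeOfVariablesRel := by
  refine ⟨n, r.slabRestrict a b, r'.slabRestrict a b, Φ, Φ',
    hΦ.mono inter_subset_left (r.slabRestrict a b).isSemialgebraic_domain,
    fun x hx => (hΦ' x hx.1).mono inter_subset_left, hinj.mono inter_subset_left, ?_,
    fun x hx => hf x hx.1, fun x hx => h0 x hx.1, rfl⟩
  ext y
  simp only [IntegralRep.domain_slabRestrict, mem_inter_iff, mem_image, mem_paramSlab]
  constructor
  · rintro ⟨hy, hya, hyb⟩
    rw [hdom] at hy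
    obtain ⟨x, hx, rfl⟩ := hy
    rw [h0 x hx] at hya hyb
    exact ⟨x, ⟨hx, hya, hyb⟩, rfl⟩
  · rintro ⟨x, ⟨hx, hxa, hxb⟩, rfl⟩
    rw [h0 x hx, hdom]
    exact ⟨mem_image_of_mem Φ hx, hxa, hxb⟩

/-- **Slab restriction of a Newton–Leibniz move over a base of dimension `≥ 1` is again such a
move**: the parameter `z 0` is a base coordinate (`(Fin.init z) 0 = z 0`), so the restricted band is
the band over the restricted base, with the same bounds and primitive.
[cite: KontsevichZagier2001, §1.2 rule (3)] -/
theorem of_slabRestrict_mem_newtonLeibnizRel {r : IntegralRep (n + 2)} {r' : IntegralRep (n + 1)}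
    {α β : (Fin (n + 1) → ℝ) → ℝ} {F : (Fin (n + 2) → ℝ) → ℝ}
    (hF : IsSemialgebraicFunOn ℚ r.domain F)
    (hα : IsSemialgebraicFunOn ℚ r'.domain α) (hβ : IsSemialgebraicFunOn ℚ r'.domain β)
    (hle : ∀ x ∈ r'.domain, α x ≤ β x)
    (hband : r.domain = {z | (Fin.init z : Fin (n + 1) → ℝ) ∈ r'.domain ∧
      α (Fin.init z) ≤ z (Fin.last (n + 1)) ∧ z (Fin.last (n + 1)) ≤ β (Fin.init z)})
    (hcont : ∀ x ∈ r'.domain, ContinuousOn (fun t : ℝ => F (Fin.snoc x t)) (Icc (α x) (β x)))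
    (hderiv : ∀ x ∈ r'.domain, ∀ t ∈ Ioo (α x) (β x),
      HasDerivAt (fun s : ℝ => F (Fin.snoc x s)) (r.integrand (Fin.snoc x t)) t)
    (hr' : ∀ x ∈ r'.domain, r'.integrand x = F (Fin.snoc x (β x)) - F (Fin.snoc x (α x)))
    (a b : ℚ) :
    of (r.slabRestrict a b) - of (r'.slabRestrict a b) ∈ newtonLeibnizRel := by
  refine ⟨n + 1, r.slabRestrict a b, r'.slabRestrict a b, α, β, F,
    hF.mono inter_subset_left (r.slabRestrict a b).isSemialgebraic_domain,
    hα.mono inter_subset_left (r'.slabRestrict a b).isSemialgebraic_domain,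
    hβ.mono inter_subset_left (r'.slabRestrict a b).isSemialgebraic_domain,
    fun x hx => hle x hx.1, ?_, fun x hx => hcont x hx.1, fun x hx => hderiv x hx.1,
    fun x hx => hr' x hx.1, rfl⟩
  ext z
  simp only [IntegralRep.domain_slabRestrict, hband, mem_inter_iff, mem_setOf_eq, mem_paramSlab]
  have h0 : Fin.init z 0 = z 0 := rfl
  rw [h0]
  tauto

/-! ### Slab restriction and slices of formal combinations -/

/-- Slab restriction on generators of `FormalRep` (dimension `0` goes to `0`).
[cite: KontsevichZagier2001, §1.2] -/
def slabGen (a b : ℚ) : (Σ k, IntegralRep k) → FormalRep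
  | ⟨0, _⟩ => 0
  | ⟨_ + 1, r⟩ => of (r.slabRestrict a b)

/-- **Slab restriction of formal combinations**: the additive map `FormalRep →+ FormalRep` sending
`[r]` (dimension `≥ 1`) to `[r|{a < z 0 < b}]` and constants to `0`.
[cite: KontsevichZagier2001, §1.2] -/
def slabMap (a b : ℚ) : FormalRep →+ FormalRep := FreeAbelianGroup.lift (slabGen a b)

/-- `slabMap` on a family. [cite: KontsevichZagier2001, §1.2] -/
@[simp] theorem slabMap_of (a b : ℚ) (r : IntegralRep (n + 1)) :
    slabMap a b (of r) = of (r.slabRestrict a b) :=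
  FreeAbelianGroup.lift_apply_of _ _

/-- `slabMap` kills constants. [cite: KontsevichZagier2001, §1.2] -/
@[simp] theorem slabMap_of_zero (a b : ℚ) (r : IntegralRep 0) : slabMap a b (of r) = 0 :=
  FreeAbelianGroup.lift_apply_of _ _

/-- Slice values on generators of `FormalRep` (dimension `0` goes to `0`). [folklore] -/
def sliceGen : (Σ k, IntegralRep k) → ℝ → ℝ
  | ⟨0, _⟩ => 0
  | ⟨_ + 1, r⟩ => sliceValue r

/-- **Slice values of formal combinations**: the additive map `FormalRep →+ (ℝ → ℝ)` extending
`[r] ↦ sliceValue r` (dimension `≥ 1`; constants go to `0`). [folklore] -/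
def sliceEval : FormalRep →+ (ℝ → ℝ) := FreeAbelianGroup.lift sliceGen

/-- `sliceEval` on a family is its slice-value function. [folklore] -/
@[simp] theorem sliceEval_of (r : IntegralRep (n + 1)) : sliceEval (of r) = sliceValue r :=
  FreeAbelianGroup.lift_apply_of _ _

/-- `sliceEval` kills constants. [folklore] -/
@[simp] theorem sliceEval_of_zero (r : IntegralRep 0) : sliceEval (of r) = 0 :=
  FreeAbelianGroup.lift_apply_of _ _

/-- The slice function of a formal combination is integrable in the parameter (Fubini,
`integrable_sliceValue`). [folklore] -/
theorem integrable_sliceEval (c : FormalRep) : Integrable (sliceEval c) := by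
  induction c using FreeAbelianGroup.induction_on with
  | zero => rw [map_zero]; exact integrable_zero ℝ ℝ volume
  | of x =>
    simp only [sliceEval, FreeAbelianGroup.lift_apply_of]
    obtain ⟨_ | k, r⟩ := x
    · exact integrable_zero ℝ ℝ volume
    · exact integrable_sliceValue r
  | neg x hx => simpa using hx.neg
  | add x y hx hy => simpa using hx.add hy

/-- **Fubini for slab restrictions of formal combinations**:
`eval (slabMap a b c) = ∫ s in (a, b), sliceEval c s`. [folklore] -/
theorem eval_slabMap (a b : ℚ) (c : FormalRep) :
    eval (slabMap a b c) = ∫ s in Ioo (a : ℝ) b, sliceEval c s := by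
  induction c using FreeAbelianGroup.induction_on with
  | zero => simp
  | of x =>
    simp only [slabMap, sliceEval, FreeAbelianGroup.lift_apply_of]
    obtain ⟨_ | k, r⟩ := x
    · simp [slabGen, sliceGen]
    · exact (eval_of _).trans (IntegralRep.value_slabRestrict r a b)
  | neg x hx => simp only [map_neg, Pi.neg_apply, integral_neg, hx]
  | add x y hx hy =>
    simp only [map_add, Pi.add_apply, hx, hy]
    exact (integral_add (integrable_sliceEval x).integrableOn
      (integrable_sliceEval y).integrableOn).symm

/-- **Slab restriction preserves fibred relations**: if `c` is a fibred relation then so is its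
restriction `slabMap a b c` to any rational slab (generatorwise: `of_slabRestrict_mem_*`; constants
restrict to `0`). [cite: KontsevichZagier2001, §1.2] -/
theorem slabMap_mem_fibredRelations {c : FormalRep} (hc : c ∈ fibredRelations) (a b : ℚ) :
    slabMap a b c ∈ fibredRelations := by
  refine (AddSubgroup.closure_le (fibredRelations.comap (slabMap a b))).mpr ?_ hc
  rintro c (((hc | hc) | hc) | hc)
  · obtain ⟨k, r, r₁, r₂, hdom, hnull, h₁, h₂, rfl⟩ := hc
    rw [AddSubgroup.coe_comap, mem_preimage, map_sub, map_sub]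
    cases k with
    | zero => simp
    | succ k =>
      rw [slabMap_of, slabMap_of, slabMap_of]
      exact mem_fibredRelations_of_mem_domainAddRel (of_slabRestrict_mem_domainAddRel hdom hnull h₁ h₂ a b)
  · obtain ⟨k, r, r₁, r₂, h₁, h₂, hadd, rfl⟩ := hc
    rw [AddSubgroup.coe_comap, mem_preimage, map_sub, map_sub]
    cases k with
    | zero => simp
    | succ k =>
      rw [slabMap_of, slabMap_of, slabMap_of]
      exact mem_fibredRelations_of_mem_integrandAddRel
        (of_slabRestrict_mem_integrandAddRel h₁ h₂ hadd a b)
  · obtain ⟨k, r, r', Φ, Φ', hΦ, hΦ', hinj, hdom, hf, h0, rfl⟩ := hc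
    rw [AddSubgroup.coe_comap, mem_preimage, map_sub, slabMap_of, slabMap_of]
    exact mem_fibredRelations_of_mem_fibredChangeOfVariablesRel
      (of_slabRestrict_mem_fibredChangeOfVariablesRel hΦ hΦ' hinj hdom hf h0 a b)
  · obtain ⟨k, r, r', α, β, F, hF, hα, hβ, hle, hband, hcont, hderiv, hr', rfl⟩ :=
      mem_fibredNewtonLeibnizRel_iff.mp hc
    rw [AddSubgroup.coe_comap, mem_preimage, map_sub, slabMap_of, slabMap_of]
    exact mem_fibredRelations_of_mem_fibredNewtonLeibnizRel (of_sub_of_mem_fibredNewtonLeibnizRel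
      (of_slabRestrict_mem_newtonLeibnizRel hF hα hβ hle hband hcont hderiv hr' a b))

/-! ### Slices of fibred relations vanish almost everywhere -/

/-- An integrable function on `ℝ` with zero integral over every open interval with rational ends is
a.e. zero (π-λ on `Real.borel_eq_generateFrom_Ioo_rat`, then
`Integrable.ae_eq_zero_of_forall_setIntegral_eq_zero`). [folklore] -/
theorem ae_eq_zero_of_forall_setIntegral_Ioo_rat_eq_zero {f : ℝ → ℝ} (hf : Integrable f)
    (h : ∀ a b : ℚ, ∫ s in Ioo (a : ℝ) b, f s = 0) : f =ᵐ[volume] 0 := by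
  have hI : ∫ s, f s = 0 := by
    have hmono : Monotone fun k : ℕ => Ioo (-(k : ℝ)) k := fun i j hij =>
      Ioo_subset_Ioo (neg_le_neg (Nat.cast_le.mpr hij)) (Nat.cast_le.mpr hij)
    have hU : (⋃ k : ℕ, Ioo (-(k : ℝ)) k) = univ :=
      eq_univ_of_forall fun x => mem_iUnion.mpr
        (let ⟨k, hk⟩ := exists_nat_gt |x|; ⟨k, abs_lt.mp hk⟩)
    have hlim := tendsto_setIntegral_of_monotone (μ := volume) (f := f)
      (fun _ => measurableSet_Ioo) hmono hf.integrableOn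
    have h0 : (fun k : ℕ => ∫ s in Ioo (-(k : ℝ)) k, f s) = fun _ => 0 := by
      funext k
      simpa using h (-k) k
    rw [h0, hU, Measure.restrict_univ] at hlim
    exact (tendsto_const_nhds_iff.mp hlim).symm
  have hcompl : ∀ t, MeasurableSet t → ∫ s in t, f s = 0 → ∫ s in tᶜ, f s = 0 := by
    intro t ht ht0
    have := integral_add_compl ht hf
    rwa [ht0, hI, zero_add] at this
  suffices H : ∀ t, MeasurableSet t → ∫ s in t, f s = 0 from
    hf.ae_eq_zero_of_forall_setIntegral_eq_zero fun t ht _ => H t ht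
  intro t ht
  induction t, ht using MeasurableSpace.induction_on_inter Real.borel_eq_generateFrom_Ioo_rat
    Real.isPiSystem_Ioo_rat with
  | empty => simp
  | basic t ht =>
    simp only [mem_iUnion, mem_singleton_iff] at ht
    obtain ⟨a, b, -, rfl⟩ := ht
    exact h a b
  | compl t ht iht => exact hcompl t ht iht
  | iUnion g hdisj hmeas hg =>
    rw [integral_iUnion hmeas hdisj hf.integrableOn]
    simp [hg]

/-- **Slab integrals of the slices of a fibred relation vanish**: for `c ∈ fibredRelations` and
rational `a b`, `∫ s in (a, b), sliceEval c s = eval (slabMap a b c) = 0` (slab restriction,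
soundness of the calculus). [cite: KontsevichZagier2001, §1.2] -/
theorem setIntegral_sliceEval_eq_zero {c : FormalRep} (hc : c ∈ fibredRelations) (a b : ℚ) :
    ∫ s in Ioo (a : ℝ) b, sliceEval c s = 0 := by
  rw [← eval_slabMap]
  exact AddMonoidHom.mem_ker.mp (fibredRelations_le_ker_eval (slabMap_mem_fibredRelations hc a b))

/-- **Slices of fibred relations vanish almost everywhere**: for `c ∈ fibredRelations`,
`sliceEval c s = 0` for a.e. parameter `s`. [cite: KontsevichZagier2001, §1.2] -/
theorem sliceEval_ae_eq_zero {c : FormalRep} (hc : c ∈ fibredRelations) :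
    sliceEval c =ᵐ[volume] 0 :=
  ae_eq_zero_of_forall_setIntegral_Ioo_rat_eq_zero (integrable_sliceEval c)
    (setIntegral_sliceEval_eq_zero hc)

namespace FibredEquivalent

/-- Fibred-equivalent families have equal slice integrals over every rational parameter interval.
[cite: KontsevichZagier2001, §1.2] -/
theorem setIntegral_sliceValue_eq {r : IntegralRep (n + 1)} {r' : IntegralRep (m + 1)}
    (h : FibredEquivalent r r') (a b : ℚ) :
    ∫ s in Ioo (a : ℝ) b, sliceValue r s = ∫ s in Ioo (a : ℝ) b, sliceValue r' s := by
  have := setIntegral_sliceEval_eq_zero h a b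
  rw [map_sub, sliceEval_of, sliceEval_of] at this
  simp only [Pi.sub_apply] at this
  rwa [integral_sub (integrable_sliceValue r).integrableOn (integrable_sliceValue r').integrableOn,
    sub_eq_zero] at this

/-- **Fibred-equivalent families have a.e. equal slice values**: if `of r − of r'` is a fibred
relation then `sliceValue r s = sliceValue r' s` for a.e. `s`. [cite: KontsevichZagier2001, §1.2] -/
theorem sliceValue_ae_eq {r : IntegralRep (n + 1)} {r' : IntegralRep (m + 1)}
    (h : FibredEquivalent r r') : sliceValue r =ᵐ[volume] sliceValue r' := by
  have := sliceEval_ae_eq_zero h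
  rw [map_sub, sliceEval_of, sliceEval_of] at this
  exact (sub_ae_eq_zero _ _).mp this

end FibredEquivalent

end KZ

end Literature.NumberTheory.Transcendental
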